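import Literature.Barriers.AtomisticToContinuum.AnticontinuumLocalizationConfigGibbs
import Literature.Probability.LatticeModels.WeaklyCoupledChain
import HarnessLib

/-!
# The configurational Gibbs measure of the rotor chain as a weakly coupled chain

`Literature/Barriers/AtomisticToContinuum/` — support file for the discharge of
`DeRoeckHuveneers2015_decorrelation_config` (`AnticontinuumLocalizationConfigGibbs.lean`).
The density `e^{-β∑_x V_x(q)}`, `V_x = γ(1 - cos q_x) + (1 - cos(q_x - q_{x+1}))`, of the
configurational Gibbs measure `ν_{N,β,γ}` (`RotorChain.configGibbs`) is the product of the
step factors `φ_j(q) = exp(-β[γ(1 - cos q_j) + (1 - cos(q_{j-1} - q_j))])`, `j < N`, each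
depending on `q_{j-1}, q_j` only and pinched in `[e^{-β(2γ+2)}, 1]`; this is exactly the datum
`BoxChain.Spec` of `Literature/Probability/LatticeModels/WeaklyCoupledChain.lean` on the box
`[0, 2π]^N`. Contents:

* `RotorChain.stepExponent`, `rotorStep`, `rotorSpec N hβ hγ : BoxChain.Spec N` (`β, γ ≥ 0`);
  `rotorSpec_ratio : ρ₀ = e^{β(2γ+2)}`; `rotorSpec_weight_zero : ∏_j φ_j = configWeight`.
* `integral_configGibbs_eq_condExp` — `∫ h dν_{N,β,γ} = E_0 h`, the
  level-`0` conditional expectation (= expectation) of the chain: the angle box `[0,2π)^N` and the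
  closed box agree a.e., the density is the chain weight, and the partition function is the
  message `R_0 > 0` (`configPartition_pos`); in particular `ν` is a probability measure
  (`integral_configGibbs_one`).
-/

noncomputable section

open MeasureTheory Function Set Filter
open scoped ENNReal NNReal

namespace Literature.Barriers.AtomisticToContinuum.HeatConduction.RotorChain

open Literature.MathematicalPhysics.KineticTheory.HeatConduction
open Literature.Probability.LatticeModels Literature.Probability.LatticeModels.BoxChain

variable {N : ℕ}

/-! ### The rotor chain as a weakly coupled chain -/

/-- The exponent of the `j`-th step factor: the part of `∑_x V_x` attached to the level `j`,
`γ(1 - cos q_j) + (1 - cos(q_{j-1} - q_j))` (no bond term for `j = 0`). [cite: DeRoeckHuveneers2015, §2.1 eq. (2.1)] -/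
def stepExponent (N : ℕ) (γ : ℝ) (j : Fin N) (q : Fin N → ℝ) : ℝ :=
  γ * (1 - Real.cos (q j)) + ∑ i : Fin N, if i.val + 1 = j.val then (1 - Real.cos (q i - q j)) else 0

/-- The `j`-th step factor `φ_j = exp(-β[γ(1 - cos q_j) + (1 - cos(q_{j-1} - q_j))])` of the
configurational Gibbs density `e^{-β∑_x V_x} = ∏_j φ_j`. [cite: DeRoeckHuveneers2015, §2.1 eq. (2.1)] -/
def rotorStep (N : ℕ) (β γ : ℝ) (j : Fin N) (q : Fin N → ℝ) : ℝ :=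
  Real.exp (-(β * stepExponent N γ j q))

/-- The step exponents are between `0` and `2γ + 2` (`γ ≥ 0`). [folklore] -/
theorem stepExponent_mem_Icc {γ : ℝ} (hγ : 0 ≤ γ) (j : Fin N) (q : Fin N → ℝ) :
    stepExponent N γ j q ∈ Icc 0 (2 * γ + 2) := by
  unfold stepExponent
  have h1 : 0 ≤ γ * (1 - Real.cos (q j)) := mul_nonneg hγ (by linarith [Real.cos_le_one (q j)])
  have h1' : γ * (1 - Real.cos (q j)) ≤ 2 * γ := by nlinarith [Real.neg_one_le_cos (q j)]
  have h2 : 0 ≤ ∑ i : Fin N, (if i.val + 1 = j.val then (1 - Real.cos (q i - q j)) else 0) :=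
    Finset.sum_nonneg fun i _ => by
      split_ifs
      · linarith [Real.cos_le_one (q i - q j)]
      · exact le_rfl
  have h2' : ∑ i : Fin N, (if i.val + 1 = j.val then (1 - Real.cos (q i - q j)) else 0) ≤ 2 := by
    calc ∑ i : Fin N, (if i.val + 1 = j.val then (1 - Real.cos (q i - q j)) else 0)
        ≤ ∑ i : Fin N, (if i.val + 1 = j.val then (2 : ℝ) else 0) := by
          refine Finset.sum_le_sum fun i _ => ?_
          split_ifs
          · linarith [Real.neg_one_le_cos (q i - q j)]
          · exact le_rfl
      _ ≤ 2 := by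
          rw [Finset.sum_ite, Finset.sum_const_zero, add_zero, Finset.sum_const, nsmul_eq_mul]
          have hc : ((Finset.univ.filter fun i : Fin N => i.val + 1 = j.val).card : ℝ) ≤ 1 := by
            exact_mod_cast Finset.card_le_one.2 fun a ha b hb => Fin.ext (by
              simp only [Finset.mem_filter] at ha hb; omega)
          nlinarith
  exact ⟨by linarith, by linarith⟩

/-- The step exponent is continuous. [folklore] -/
theorem continuous_stepExponent (N : ℕ) (γ : ℝ) (j : Fin N) : Continuous (stepExponent N γ j) := by
  unfold stepExponent
  refine (continuous_const.mul (continuous_const.sub (Real.continuous_cos.comp (continuous_apply j)))).add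
    (continuous_finsetSum _ fun i _ => ?_)
  split_ifs
  · exact continuous_const.sub (Real.continuous_cos.comp ((continuous_apply i).sub (continuous_apply j)))
  · exact continuous_const

/-- The step exponent of the level `j` depends on `q_{j-1}, q_j` only. [folklore] -/
theorem dependsOn_stepExponent (N : ℕ) (γ : ℝ) (j : Fin N) :
    DependsOn (stepExponent N γ j) {i : Fin N | i.val + 1 = j.val ∨ i = j} := by
  intro q q' h
  unfold stepExponent
  have hj : q j = q' j := h j (Or.inr rfl)
  rw [hj]
  congr 1
  refine Finset.sum_congr rfl fun i _ => ?_
  split_ifs with hi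
  · rw [h i (Or.inl hi)]
  · rfl

/-- **The rotor chain as a `BoxChain.Spec`**: box `[0, 2π]^N`, step factors `rotorStep`,
pinched in `[e^{-β(2γ+2)}, 1]` (`β, γ ≥ 0`). [cite: DeRoeckHuveneers2015, §2.1 eq. (2.1)] -/
def rotorSpec (N : ℕ) {β γ : ℝ} (hβ : 0 ≤ β) (hγ : 0 ≤ γ) : BoxChain.Spec N where
  L := 2 * Real.pi
  φ := rotorStep N β γ
  φlo := Real.exp (-(β * (2 * γ + 2)))
  φhi := 1
  L_pos := Real.two_pi_pos
  φlo_pos := Real.exp_pos _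
  φlo_le j q := by
    unfold rotorStep
    exact Real.exp_le_exp.2 (neg_le_neg (mul_le_mul_of_nonneg_left (stepExponent_mem_Icc hγ j q).2 hβ))
  le_φhi j q := by
    unfold rotorStep
    rw [Real.exp_le_one_iff, neg_nonpos]
    exact mul_nonneg hβ (stepExponent_mem_Icc hγ j q).1
  continuous_φ j := Real.continuous_exp.comp (continuous_const.mul (continuous_stepExponent N γ j)).neg
  dependsOn_φ j := fun q q' h => by
    show rotorStep N β γ j q = rotorStep N β γ j q'
    unfold rotorStep
    rw [dependsOn_stepExponent N γ j h]

/-- The box side of the rotor spec is `2π`. [folklore] -/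
@[simp] theorem rotorSpec_L {β γ : ℝ} (hβ : 0 ≤ β) (hγ : 0 ≤ γ) : (rotorSpec N hβ hγ).L = 2 * Real.pi := rfl

/-- The ratio `ρ₀ = φ₊/φ₋` of the rotor spec is `e^{β(2γ+2)}`. [folklore] -/
theorem rotorSpec_ratio {β γ : ℝ} (hβ : 0 ≤ β) (hγ : 0 ≤ γ) :
    (rotorSpec N hβ hγ).ratio = Real.exp (β * (2 * γ + 2)) := by
  show (1 : ℝ) / Real.exp (-(β * (2 * γ + 2))) = _
  rw [Real.exp_neg, one_div, inv_inv]

/-- **The full weight of the rotor spec is the configurational Boltzmann weight**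
`∏_j φ_j = e^{-β∑_x V_x}`. [cite: DeRoeckHuveneers2015, §2.1 eq. (2.1)] -/
theorem rotorSpec_weight_zero {β γ : ℝ} (hβ : 0 ≤ β) (hγ : 0 ≤ γ) (q : Fin N → ℝ) :
    (rotorSpec N hβ hγ).weight 0 q = configWeight N β γ q := by
  show ∏ j ∈ Spec.tail (N := N) 0, rotorStep N β γ j q = configWeight N β γ q
  rw [Spec.tail_zero]
  unfold rotorStep configWeight
  rw [← Real.exp_sum]
  congr 1
  rw [Finset.sum_neg_distrib, ← Finset.mul_sum, neg_mul]
  congr 2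
  -- `∑_j stepExponent j = ∑_x V_x`
  unfold stepExponent sitePotential
  rw [Finset.sum_add_distrib, Finset.sum_add_distrib]
  congr 1
  rw [Finset.sum_comm]
  refine Finset.sum_congr rfl fun x _ => Finset.sum_congr rfl fun y _ => ?_
  by_cases h : y.val = x.val + 1
  · rw [if_pos h.symm, if_pos h]
  · rw [if_neg (fun h' => h h'.symm), if_neg h]

/-! ### Gibbs averages of continuous observables are expectations of the chain -/

/-- The angle box differs from the closed box by a null set. [folklore] -/
theorem angleBox_ae_eq_box (N : ℕ) :
    angleBox N =ᵐ[(volume : Measure (Fin N → ℝ))] Set.pi univ fun _ : Fin N => Icc 0 (2 * Real.pi) := by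
  rw [angleBox, volume_pi]
  exact Measure.pi_Ico_ae_eq_pi_Icc

/-- A set integral over the angle box is a full box marginal of the chain. [folklore] -/
theorem setIntegral_angleBox_eq_marginal (F : (Fin N → ℝ) → ℝ) :
    ∫ q in angleBox N, F q = BoxChain.marginal (2 * Real.pi) Finset.univ F 0 := by
  rw [BoxChain.marginal_univ, setIntegral_congr_set (angleBox_ae_eq_box N)]

/-- The configurational partition function is the message `R_0` of the chain. [folklore] -/
theorem configPartition_eq_msg {β γ : ℝ} (hβ : 0 ≤ β) (hγ : 0 ≤ γ) :
    configPartition N β γ = (rotorSpec N hβ hγ).msg 0 0 := by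
  rw [configPartition, setIntegral_angleBox_eq_marginal]
  show _ = BoxChain.marginal (2 * Real.pi) (Spec.tail (N := N) 0) ((rotorSpec N hβ hγ).weight 0) 0
  rw [Spec.tail_zero]
  congr 1
  funext q
  rw [rotorSpec_weight_zero]

/-- The configurational partition function is positive. [folklore] -/
theorem configPartition_pos {β γ : ℝ} (hβ : 0 ≤ β) (hγ : 0 ≤ γ) : 0 < configPartition N β γ := by
  rw [configPartition_eq_msg hβ hγ]
  exact Spec.msg_pos _ 0 0

/-- **Gibbs averages are chain expectations**: `∫ h dν_{N,β,γ} = E_0 h` (the level-`0`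
conditional expectation of the rotor spec; both sides are Bochner integrals of `h` against the
normalised weight on the box, so no hypothesis on `h` is needed). [cite: DeRoeckHuveneers2015, §2.2] -/
theorem integral_configGibbs_eq_condExp {β γ : ℝ} (hβ : 0 ≤ β) (hγ : 0 ≤ γ) (h : (Fin N → ℝ) → ℝ) :
    ∫ q, h q ∂(configGibbs N β γ) = (rotorSpec N hβ hγ).condExp 0 h 0 := by
  have hZ := configPartition_pos (N := N) hβ hγ
  have hw : Measurable fun q : Fin N → ℝ => ((configWeight N β γ q).toNNReal : ℝ≥0) :=
    (continuous_configWeight N β γ).measurable.real_toNNReal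
  rw [configGibbs, integral_smul_measure]
  have e1 : (fun q : Fin N → ℝ => ENNReal.ofReal (configWeight N β γ q)) =
      fun q => ((configWeight N β γ q).toNNReal : ℝ≥0∞) := rfl
  rw [e1, integral_withDensity_eq_integral_smul hw]
  have e2 : (fun q : Fin N → ℝ => (configWeight N β γ q).toNNReal • h q) =
      fun q => h q * configWeight N β γ q := by
    funext q
    rw [NNReal.smul_def, Real.coe_toNNReal _ (configWeight_pos N β γ q).le, smul_eq_mul, mul_comm]
  rw [e2, setIntegral_angleBox_eq_marginal, ENNReal.toReal_inv, ENNReal.toReal_ofReal hZ.le,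
    configPartition_eq_msg hβ hγ]
  show _ = BoxChain.marginal (2 * Real.pi) (Spec.tail (N := N) 0) (fun p => h p * (rotorSpec N hβ hγ).weight 0 p) 0 /
    (rotorSpec N hβ hγ).msg 0 0
  rw [Spec.tail_zero, smul_eq_mul, inv_mul_eq_div]
  congr 2
  funext q
  rw [rotorSpec_weight_zero]

/-- The configurational Gibbs measure is a probability measure (`β, γ ≥ 0`). [cite: DeRoeckHuveneers2015, §2.2] -/
theorem integral_configGibbs_one {β γ : ℝ} (hβ : 0 ≤ β) (hγ : 0 ≤ γ) :
    ∫ _q, (1 : ℝ) ∂(configGibbs N β γ) = 1 := by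
  rw [integral_configGibbs_eq_condExp hβ hγ (fun _ => (1 : ℝ)), Spec.condExp_one]

end Literature.Barriers.AtomisticToContinuum.HeatConduction.RotorChain

end
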